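import Literature.NumberTheory.ModularForms.ModularCurveCuspForms
import Literature.NumberTheory.ModularForms.ModularCurvePeriodCharacters
import Literature.NumberTheory.Automorphic.CuspFormRePeriodInjectiveArithmetic
import Literature.Geometry.Kaehler.RiemannSurfaceRealPeriodsPrescribed
import HarnessLib

/-!
# Eichler–Shimura in weight two, SURJECTIVITY half, for torsion-free finite-index subgroups of `SL₂(ℤ)`
# (Shimura Thm. 8.4, `n = 0`; the engine behind `eichlerShimura_weightTwo_rePeriod_surjective_Gamma_holds`)

Topic `NumberTheory/Automorphic`; THEOREMS ONLY. G. Shimura, *Introduction to the arithmetic theory of automorphic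
functions* (1971), Thm. 8.4 p. 234 at `n = 0`, `Ψ = 1`: for a Fuchsian group of the first kind `Γ` the real-period map
`S₂(Γ) → H¹_P(Γ, ℝ)`, `F ↦ (γ ↦ Re ∫_{z₀}^{γz₀} F)`, is an isomorphism ONTO the parabolic cocycles. Here, for a
finite-index `Γ ≤ SL₂(ℤ)` acting freely on `ℍ` (e.g. `Γ(M)`, `M ≥ 3`):

* `isCancelSMul_of_forall_isOfFinOrder` — a finite-index `Γ ≤ SL₂(ℤ)` whose only element of finite order is `1` acts
  freely on `ℍ`;
* ★ `exists_cuspForm_rePeriod_eq` — **every additive parabolic-null `u : Γ → ℝ` is the real-period cochain of a weight-two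
  cusp form on `Γ`.** Proof = the dimension count of the cocompact case (Summit crux 24801, `…CartanCoverPrintClausesSurjective`)
  run on the COMPACTIFIED MODULAR CURVE `X(Γ)` of `Literature/NumberTheory/ModularForms/ModularCurve*.lean`:
  `dim Ω¹(X(Γ)) ≤ dim S₂(Γ)` (pull-back `cuspFormOfDevelopment`, injective), `dim S₂(Γ) ≤ dim H¹_P(Γ, ℝ)` (real periods,
  injective by the tree's `CuspForm.eq_zero_of_forall_rePeriod_eq_zero_of_isArithmetic`), `H¹_P(Γ, ℝ) ⊆` the restrictions of
  characters of `π₁(X(Γ))` along `γ ↦ loopClass γ` (`exists_character_comp_loopClass`), and `dim Hom(π₁(X(Γ)), ℝ) = dim Ω¹(X(Γ))`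
  (the tree's `RiemannSurface.rePeriodCharacter`, Farkas–Kra III.3.4 (b)); so all dimensions agree and the period map is onto;
* the instance `Γ(M)`, `M ≥ 3`, and the discharge `eichlerShimura_weightTwo_rePeriod_surjective_Gamma_holds` of the named fact
  (ESᶜ-surj-Γ(M)) are the two-line sequel `EichlerShimuraWeightTwoGammaHolds.lean` (kept apart only for its extra import
  `ModularForms/CongruenceSubgroupsNeat`).

HONEST FRAMING. This discharges one of the seven print conjuncts of the cite stub of crux `stmt-BirchSwinnertonDyer-24801`
(line `lattice`: the surjectivity residue (ESᶜ-surj-split) reduces to Γ(M) in the tree); nothing about NUM or any curve is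
proved and BSD is proved for no curve.

## References

* G. Shimura, *Introduction to the arithmetic theory of automorphic functions* (1971), Thm. 8.4 p. 234; §8.1–8.2; §1.5–1.6.
  [ShimuraIATAF1971]
* H. M. Farkas, I. Kra, *Riemann Surfaces*, GTM 71 (1992), III.3.4 Corollary (b). [FarkasKra1992]
* F. Diamond, J. Shurman, *A first course in modular forms*, GTM 228 (2005), §2.3 Exercise 2.3.7, §3.3. [DiamondShurman2005]
-/

noncomputable section

open scoped MatrixGroups Manifold ContDiff Topology ModularForm
open Set Filter Function
open Literature.NumberTheory.ModularForms Literature.NumberTheory.ModularForms.ModularCurve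
open Literature.Geometry.Kaehler Literature.Geometry.Kaehler.RiemannSurface

namespace Literature.NumberTheory.Automorphic

/-! ### Free action of torsion-free finite-index subgroups of `SL₂(ℤ)` -/

/-- **A finite-index `Γ ≤ SL₂(ℤ)` without non-trivial elements of finite order acts freely on `ℍ`** (a stabiliser of a
properly discontinuous action is finite, hence consists of elements of finite order). [cite: DiamondShurman2005, §2.3 Exercise 2.3.7] -/
theorem isCancelSMul_of_forall_isOfFinOrder (Γ : Subgroup SL(2, ℤ)) [Γ.FiniteIndex]
    (htf : ∀ γ : SL(2, ℤ), γ ∈ Γ → IsOfFinOrder γ → γ = 1) :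
    IsCancelSMul (Γ : Subgroup (GL (Fin 2) ℝ)) UpperHalfPlane := by
  refine isCancelSMul_iff_eq_one_of_smul_eq.mpr fun γ τ hγτ => ?_
  -- the stabiliser of `τ` is finite
  have hfin : (MulAction.stabilizer (Γ : Subgroup (GL (Fin 2) ℝ)) τ : Set (Γ : Subgroup (GL (Fin 2) ℝ))).Finite := by
    have h := ProperlyDiscontinuousSMul.finite_disjoint_inter_image (Γ := (Γ : Subgroup (GL (Fin 2) ℝ))) (T := UpperHalfPlane)
      (isCompact_singleton (x := τ)) (isCompact_singleton (x := τ))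
    refine h.subset fun δ hδ => ?_
    have hδ' : δ • τ = τ := hδ
    exact ⟨τ, ⟨τ, rfl, hδ'⟩, rfl⟩
  have hmem : γ ∈ MulAction.stabilizer (Γ : Subgroup (GL (Fin 2) ℝ)) τ := hγτ
  haveI : Finite (MulAction.stabilizer (Γ : Subgroup (GL (Fin 2) ℝ)) τ) := hfin.to_subtype
  have hfo : IsOfFinOrder γ :=
    (MulAction.stabilizer _ τ).subtype.isOfFinOrder (isOfFinOrder_of_finite (⟨γ, hmem⟩ : MulAction.stabilizer _ τ))
  -- transport to `SL₂(ℤ)`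
  obtain ⟨g, hg, hgγ⟩ := γ.2
  have hfo' : IsOfFinOrder g := by
    obtain ⟨n, hn, hγn⟩ := hfo.exists_pow_eq_one
    refine isOfFinOrder_iff_pow_eq_one.2 ⟨n, hn, ?_⟩
    have h1 : (Matrix.SpecialLinearGroup.mapGL ℝ) (g ^ n) = 1 := by
      rw [map_pow, hgγ]; exact congrArg Subtype.val hγn
    have hinj : Function.Injective (Matrix.SpecialLinearGroup.mapGL ℝ : SL(2, ℤ) → GL (Fin 2) ℝ) := by
      intro a b hab
      ext i j
      have := congrArg (fun m : GL (Fin 2) ℝ => (m : Matrix (Fin 2) (Fin 2) ℝ) i j) hab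
      simpa [Matrix.SpecialLinearGroup.mapGL] using this
    exact hinj (by rw [h1, map_one])
  have := htf g hg hfo'
  subst this
  exact Subtype.ext (by rw [← hgγ, map_one]; rfl)

/-! ### The dimension count on `X(Γ)` -/

section Surjective

variable (Γ : Subgroup SL(2, ℤ)) [Γ.FiniteIndex] [IsCancelSMul (Γ : Subgroup (GL (Fin 2) ℝ)) UpperHalfPlane]

/-- ★ **EICHLER–SHIMURA SURJECTIVITY (Shimura Thm. 8.4, `n = 0`) for a finite-index `Γ ≤ SL₂(ℤ)` acting freely on `ℍ`**: every
additive `u : Γ → ℝ` vanishing on the parabolic elements of `Γ` is the real-period cochain `γ ↦ Re ∫_{z₀}^{γz₀} F` of a weight-two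
cusp form `F` on `Γ`. [cite: ShimuraIATAF1971, Thm. 8.4 p. 234] [cite: FarkasKra1992, III.3.4 Corollary (b)] -/
theorem exists_cuspForm_rePeriod_eq (z₀ : UpperHalfPlane) (u : ↥(Γ : Subgroup (GL (Fin 2) ℝ)) → ℝ)
    (hu : ∀ γ δ, u (γ * δ) = u γ + u δ)
    (hpar : ∀ γ : (Γ : Subgroup (GL (Fin 2) ℝ)), (γ : GL (Fin 2) ℝ).IsParabolic → u γ = 0) :
    ∃ F : CuspForm (Γ : Subgroup (GL (Fin 2) ℝ)) 2, ∀ γ, CuspForm.rePeriod F z₀ γ = u γ := by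
  classical
  set M := Cpt Γ with hM
  let x₀ : M := basePt Γ
  -- the real vector spaces
  let V := ↥(holomorphicOneForms M)
  let W₀ := Additive (FundamentalGroup M x₀) →+ ℝ
  let T := ↥(Γ : Subgroup (GL (Fin 2) ℝ)) → ℝ
  let S := CuspForm (Γ : Subgroup (GL (Fin 2) ℝ)) 2
  haveI : Module.Finite ℂ V := moduleFinite_holomorphicOneForms (M := M)
  haveI : Module.Finite ℝ V := Module.Finite.trans ℂ V
  let RC : V ≃ₗ[ℝ] W₀ := rePeriodCharacter x₀
  haveI : Module.Finite ℝ W₀ := Module.Finite.equiv RC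
  -- the parabolic cochains, a submodule of `T`
  let Wpar : Submodule ℝ T :=
    { carrier := {f | (∀ γ δ, f (γ * δ) = f γ + f δ) ∧ ∀ γ : (Γ : Subgroup (GL (Fin 2) ℝ)), (γ : GL (Fin 2) ℝ).IsParabolic → f γ = 0}
      add_mem' := fun {f g} hf hg => ⟨fun γ δ => by show f (γ * δ) + g (γ * δ) = (f γ + g γ) + (f δ + g δ); rw [hf.1, hg.1]; ring,
        fun γ hγ => by show f γ + g γ = 0; rw [hf.2 γ hγ, hg.2 γ hγ, add_zero]⟩
      zero_mem' := ⟨fun _ _ => by show (0 : ℝ) = 0 + 0; rw [add_zero], fun _ _ => rfl⟩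
      smul_mem' := fun c f hf => ⟨fun γ δ => by show c • f (γ * δ) = c • f γ + c • f δ; rw [hf.1, smul_add],
        fun γ hγ => by show c • f γ = 0; rw [hf.2 γ hγ, smul_zero]⟩ }
  -- the restriction of characters of `π₁(X(Γ))` along `loopClass`
  let ρ : W₀ →ₗ[ℝ] T :=
    { toFun := fun χ γ => χ (Additive.ofMul (loopClass Γ γ))
      map_add' := fun _ _ => rfl
      map_smul' := fun _ _ => rfl }
  have hWρ : Wpar ≤ LinearMap.range ρ := by
    intro f hf
    obtain ⟨χ, hχ⟩ := exists_character_comp_loopClass (Γ := Γ) (u := f) hf.1 hf.2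
    exact ⟨χ, funext hχ⟩
  haveI : Module.Finite ℝ (LinearMap.range ρ) := inferInstance
  haveI hWfin : Module.Finite ℝ Wpar := Submodule.finiteDimensional_of_le hWρ
  -- the period map `P : S →ₗ[ℝ] T`
  let P : S →ₗ[ℝ] T :=
    { toFun := fun F γ => CuspForm.rePeriod F z₀ γ
      map_add' := fun F G => funext fun γ => CuspForm.rePeriod_add F G z₀ γ
      map_smul' := fun c F => funext fun γ => by
        show CuspForm.rePeriod (c • F) z₀ γ = c • CuspForm.rePeriod F z₀ γ
        rw [CuspForm.rePeriod_smul, smul_eq_mul] }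
  have hPinj : Function.Injective P := by
    refine (injective_iff_map_eq_zero P).mpr fun F hF => ?_
    exact CuspForm.eq_zero_of_forall_rePeriod_eq_zero_of_isArithmetic z₀ F fun γ => congrFun hF γ
  have hPW : LinearMap.range P ≤ Wpar := by
    rintro _ ⟨F, rfl⟩
    exact ⟨fun γ δ => CuspForm.rePeriod_mul F z₀ γ δ, fun γ hγ => CuspForm.rePeriod_eq_zero_of_isParabolic F z₀ hγ⟩
  haveI : Module.Finite ℝ (LinearMap.range P) := Submodule.finiteDimensional_of_le hPW
  let eP : S ≃ₗ[ℝ] LinearMap.range P := LinearEquiv.ofInjective P hPinj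
  haveI : Module.Finite ℝ S := Module.Finite.equiv eP.symm
  -- the pull-back `D : V →ₗ[ℝ] S`
  have hdev : ∀ θ : V, ∃ Fd : UpperHalfPlane → ℂ, (θ : MeromorphicOneForm M).IsDevelopment (toCpt Γ) Fd ∧ Fd UpperHalfPlane.I = 0 :=
    fun θ => exists_isDevelopment_toCpt (mem_holomorphicOneForms_iff.mp θ.2)
  choose dev hdev _ using hdev
  have hhol : ∀ θ : V, (θ : MeromorphicOneForm M).IsHolomorphic := fun θ => mem_holomorphicOneForms_iff.mp θ.2
  let D : V →ₗ[ℝ] S :=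
    { toFun := fun θ => cuspFormOfDevelopment (hhol θ) (hdev θ)
      map_add' := fun θ₁ θ₂ => by
        apply DFunLike.coe_injective
        change devDeriv (dev (θ₁ + θ₂)) = fun τ => devDeriv (dev θ₁) τ + devDeriv (dev θ₂) τ
        rw [← devDeriv_add (hdev θ₁) (hdev θ₂)]
        have hsum : ((θ₁ + θ₂ : V) : MeromorphicOneForm M).IsDevelopment (toCpt Γ) (fun τ => dev θ₁ τ + dev θ₂ τ) :=
          (hdev θ₁).add (hdev θ₂)
        exact devDeriv_eq_of_isDevelopment (hdev (θ₁ + θ₂)) hsum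
      map_smul' := fun c θ => by
        apply DFunLike.coe_injective
        change devDeriv (dev (c • θ)) = ⇑(c • cuspFormOfDevelopment (hhol θ) (hdev θ))
        have hcoe : (⇑(c • cuspFormOfDevelopment (hhol θ) (hdev θ)) : UpperHalfPlane → ℂ) = fun τ => (c : ℂ) * devDeriv (dev θ) τ := by
          funext τ
          rw [CuspForm.smul_apply, coe_cuspFormOfDevelopment, Complex.real_smul]
        rw [hcoe, ← devDeriv_const_mul (hdev θ) (c : ℂ)]
        have hsm : ((c • θ : V) : MeromorphicOneForm M).IsDevelopment (toCpt Γ) (fun τ => (c : ℂ) * dev θ τ) := by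
          have h := (hdev θ).smul (c : ℂ)
          have e2 : ((c • θ : V) : MeromorphicOneForm M) = (c : ℂ) • (θ : MeromorphicOneForm M) := by
            rw [Submodule.coe_smul_of_tower, Complex.coe_smul]
          rw [e2]; exact h
        exact devDeriv_eq_of_isDevelopment (hdev (c • θ)) hsm }
  have hDinj : Function.Injective D := by
    refine (injective_iff_map_eq_zero D).mpr fun θ hθ => ?_
    exact Subtype.ext (eq_zero_of_cuspFormOfDevelopment_eq_zero (hhol θ) (hdev θ) hθ)
  -- dimension count
  have h1 : Module.finrank ℝ V ≤ Module.finrank ℝ S := LinearMap.finrank_le_finrank_of_injective hDinj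
  have h2 : Module.finrank ℝ S = Module.finrank ℝ (LinearMap.range P) := eP.finrank_eq
  have h3 : Module.finrank ℝ (LinearMap.range P) ≤ Module.finrank ℝ Wpar := Submodule.finrank_mono hPW
  have h4 : Module.finrank ℝ Wpar ≤ Module.finrank ℝ (LinearMap.range ρ) := Submodule.finrank_mono hWρ
  have h5 : Module.finrank ℝ (LinearMap.range ρ) ≤ Module.finrank ℝ W₀ := LinearMap.finrank_range_le ρ
  have h6 : Module.finrank ℝ W₀ = Module.finrank ℝ V := RC.symm.finrank_eq
  have heq : LinearMap.range P = Wpar := Submodule.eq_of_le_of_finrank_eq hPW (by omega)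
  -- conclude
  have huW : (u : T) ∈ Wpar := ⟨hu, hpar⟩
  rw [← heq] at huW
  obtain ⟨F, hF⟩ := huW
  exact ⟨F, fun γ => congrFun hF γ⟩

end Surjective

end Literature.NumberTheory.Automorphic

end
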